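import Literature.MathematicalPhysics.QuantumFieldTheory.BalabanImbrieJaffe1984to88.BIJ88Extraction311Bound

/-!
# `BalabanImbrieJaffe1984to88.BIJ88Extraction311TwoCase` — T. Bałaban, J. Imbrie, A. Jaffe, *Effective action and cluster properties of the
abelian Higgs model*, Commun. Math. Phys. **114** (1988) 257–315 [BalabanImbrieJaffe1988]: Sect. 5.14, p. 311 [PDF 55] — THE TWO-CASE BOUND
*"|W₆^{(k)}(X)| ≤ (e^β(L^kε/ε₀)^{1/4−α})^{n̄+1+β′|X|}, dist(X, Λ₁₂^{(k),c}) ≥ r(e_k); (e^β(L^kε/ε₀)^{1/4−α})^{β′|X|}, otherwise"* ASSEMBLED for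
`W₆ = W₆′ + W₆″` with the `W₆″ = W6pp` DEFINED in `BIJ88Extraction311`, from the source majorants of `BIJ88Extraction311Bound` and the arithmetic of
*"(We allow adjustments in β, α, β′, keeping them small.)"*: r16's leaf **`BIJ88Sect5StatementsPart2.IneqW6` INHABITED** for that `W₆`, the `W₆′` half
entering only through the leaf **`BIJ88Sect5StatementsPart2.IneqW6′`** (which p25's `BIJ88W6PrimeBound.ineqW6'_of_ineq5144` produces from `Ineq5144`)

statement-level skeleton of published theorems with citation tags; proofs where landed; nothing here is a claim about the Yang–Mills mass gap

PDF held: `paper:balaban1988-cmp114-bij-abelian-higgs-effective-action` (journal page = PDF page + 256); pp. 310–311 [PDF 54–55] read this session as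
images (`HOME/lit-balaban-p31/renders/original-p054/p055-x2.png`).

CITATION HEADER (verbatim).  p. 311 [PDF 55]: *"Altogether we have written V^{(k)}_{const}(Λ₈^{(k)}) + 𝒫̃_{k+1}(Λ₁₂^{(k)}) = 𝒫^L_{k+1,loc}(Λ₈^{(k)}) +
Σ_X W₆^{(k)″}(X). If we put W₆^{(k)}(X) = W₆^{(k)′}(X) + W₆^{(k)″}(X), then W₆^{(k)}(X) obeys |W₆^{(k)}(X)| ≤ (e^β(L^kε/ε₀)^{1/4−α})^{n̄+1+β′|X|},
dist(X, Λ₁₂^{(k),c}) ≥ r(e_k); (e^β(L^kε/ε₀)^{1/4−α})^{β′|X|}, otherwise. We then resum the polymer expansion as in (5.11.1) to obtain the effective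
action ℰ_{k+1,Λ₈^{(k)}} of (5.11.2)."*; p. 310 [PDF 54]: *"|W₆^{(k)′}(X)| ≤ (e^β(L^kε/ε₀)^{1/4−α})^{n̄+1+β′|X|}. (We allow adjustments in β, α, β′,
keeping them small.)"*.

WHAT IS REPRODUCED.  SKELETON row **C2.Claim@310** of `HOME/lit-balaban-r16/ROWS-C2-part2.md` (head typed; typed leaf `BIJ88Sect5StatementsPart2.IneqW6`,
r16 p240155); third file (F-B2) of this seat's p. 311 block after `BIJ88ScalarComposition311` (p319635, member at v2.92) and `BIJ88Extraction311` (F-B1,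
p319972: the extraction identity with `W₆″` DEFINED, `h311` of `BIJ88Result5145.eq5145` discharged).  Cell `lit-balaban`, HOME
`run/shared/lean/pub/lit-balaban/`; Phase-2 seat p31 gen 12 = unit `lit-balaban-p31-g12`; TAKING line HOME/STATUS.md 2026-08-22T05:17:14Z; owner r16,
referee ref-5.  W₆-LEAVES FED BY NAME: **`IneqW6`** (conclusion of `ineqW6_of_extraction`) and **`IneqW6′`** (its `W₆′` hypothesis; produced from the
leaf `Ineq5144` by p25's `BIJ88W6PrimeBound.ineqW6'_of_ineq5144`, p252063).

WHAT IS PROVED (theorems only; 0 `sorry`; 0 defs / 0 `Prop` facts).  Notation and the printed-shape source bounds (T), (RW), (B), (N) as in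
`BIJ88Extraction311Bound`; θ the vertex factor, `cr = c·r(e_k)`, `b₁ = 1 + M b₀`, `far X → X ⊆ W′`.
§2 THE ARITHMETIC of the adjustments — explicit sufficient smallness conditions on an adjusted pair `0 < θ′ ≤ 1`, `0 ≤ β′`: (S1a) `2q^M e^{−cr/4} ≤ θ′^{β′}`,
  (S1b) `4|D|θe^{−cr/4} ≤ θ′^{n̄+1}`, (S2) `4|D|θ^{n̄+1} ≤ θ′^{n̄+1+β′}`, (S3) `4|D|θ ≤ θ′^{β′}`, (S4) `4|D|θ(2q^M)^{b₁} ≤ (θ′^{β′})^{b₁}` (all satisfiable for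
  `r(e_k)` large and θ small, `β′` small — the printed *"adjustments"*): `abs_piecePart_le_far_rpow` (far: source (i) ≤ `¼θ′^{n̄+1+β′|X|}`),
  `abs_piecePart_le_near_rpow` (≤ `¼θ′^{β′|X|}`), `abs_highPart_le_rpow` (≤ `¼θ′^{n̄+1+β′|X|}`), `abs_relocPart_le_rpow` (≤ `¼θ′^{β′|X|}`), `quarter_of_ineqW6'`
  (`W₆′`: the leaf `IneqW6′` at `(θ₁, β₁)` with `4θ₁^{n̄+1} ≤ θ′^{n̄+1}`, `θ₁^{β₁} ≤ θ′^{β′}` gives `≤ ¼θ′^{n̄+1+β′|X|}`).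
§3 **`ineqW6_of_parts`** (assembly of the four quarter-bounds into the two cases: at far `X` source (iii) vanishes and everything carries `θ′^{n̄+1}`;
  otherwise only `θ′^{β′|X|}` survives) and **`ineqW6_of_extraction`**: under (T), (RW), (B), (N), `far X → X ⊆ W′`, (S1a)–(S4) and
  `IneqW6′ (cubeSys ι) W₆′ θ₁ β₁ n̄` (+ the two comparison conditions):
  **`IneqW6 (cubeSys ι) (fun X => W₆′ X + W6pp … A W′ X) far θ′ β′ n̄`** — r16's leaf inhabited for `W₆ = W₆′ + W₆″` with THAT `W₆″`.
HONEST SCOPE.  As in `BIJ88Extraction311Bound`: the source bounds are displayed hypotheses in the printed shapes, not derived from Sects. 2–4; the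
constants of the conclusion are ADJUSTED ones under explicit sufficient conditions (no optimisation of `β′`, no claim that the printed `β′` is
attained); the reading of `BIJ88Extraction311` is inherited.  Nothing on (5.14.4) or on `W₆′` beyond the leaf `IneqW6′` by name; nothing on the
resummation *"as in (5.11.1)"* (rows C2.Eq5.11.x).  NOT summit progress.
-/

namespace Literature.MathematicalPhysics.QuantumFieldTheory.BalabanImbrieJaffe1984to88.BIJ88Extraction311TwoCase

open Finset
open Literature.MathematicalPhysics.QuantumFieldTheory.BalabanImbrieJaffe1984to88.BIJ88Sect5StatementsPart2 (IneqW6 IneqW6')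
open Literature.MathematicalPhysics.QuantumFieldTheory.BalabanImbrieJaffe1984to88.BIJ88Ineq5113Covering (cubeSys cubeSys_card)
open Literature.MathematicalPhysics.QuantumFieldTheory.BalabanImbrieJaffe1984to88.BIJ88Extraction311 (choices term std loc W6pp)
open Literature.MathematicalPhysics.QuantumFieldTheory.BalabanImbrieJaffe1984to88.BIJ88Extraction311Bound (abs_std_le abs_piecePart_le_far
  abs_piecePart_le_near abs_highPart_le highPart_eq_zero_of_card_ne_one abs_relocPart_le relocPart_eq_zero_of_card_ne_one relocPart_eq_zero_of_far)

noncomputable section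

variable {ι : Type} [DecidableEq ι]
variable {S : Type*} {K : Type*} [AddCommGroup K] [Module ℝ K]
variable {D : Type*} [Fintype D] {P : Type*} [DecidableEq P]
variable (m : D → ℕ) (spec : (γ : D) → Fin (m γ) → S) (T : (γ : D) → ι → MultilinearMap ℝ (fun _ : Fin (m γ) => K) ℝ)
variable (Cstd : S → K) (pc : S → Finset P) (E : S → P → K) (reg : P → Finset ι) (ord : D → ℕ) (nbar : ℕ)


/-! ## §2 The arithmetic of the adjustments *"(We allow adjustments in β, α, β′, keeping them small.)"* -/

/-- kernel: `θ^{a + b·n} = θ^a·(θ^b)^n` for `θ > 0`. [folklore] -/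
private theorem rpow_lin {θ : ℝ} (hθ : 0 < θ) (a b : ℝ) (n : ℕ) : θ ^ (a + b * n) = θ ^ a * (θ ^ b) ^ n := by
  rw [Real.rpow_add hθ, Real.rpow_mul hθ.le, Real.rpow_natCast]

/-- kernel: `n·u^n·v^n ≤ (2uv)^n` for `u, v ≥ 0` (`n ≤ 2^n`). [folklore] -/
private theorem nat_mul_pow_le {u v : ℝ} (hu : 0 ≤ u) (hv : 0 ≤ v) (n : ℕ) : (n : ℝ) * u ^ n * v ^ n ≤ (2 * u * v) ^ n := by
  have hn : (n : ℝ) ≤ 2 ^ n := by exact_mod_cast n.lt_two_pow_self.le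
  calc (n : ℝ) * u ^ n * v ^ n ≤ 2 ^ n * u ^ n * v ^ n := by gcongr
    _ = (2 * u * v) ^ n := by rw [mul_pow, mul_pow]

/-- **Source (i) at a far `X`, printed shape**: `|piece part(X)| ≤ ¼·θ′^{n̄+1+β′|X|}` under (S1a) `2q^M e^{−cr/4} ≤ θ′^{β′}` and (S1b)
`4|D|θ e^{−cr/4} ≤ θ′^{n̄+1}` (`r(e_k)` large: the factor *"e^{−cr(e_k)|X|}"* beats the powers of the couplings and the multiplicity).
[cite: BalabanImbrieJaffe1988, p.311 (Sect. 5.14)] -/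
theorem abs_piecePart_le_far_rpow {q M : ℕ} (hq : 1 ≤ q) (hN : ∀ s X, ((pc s).filter (fun r => reg r ⊆ X)).card + 1 ≤ q ^ X.card)
    (hM : ∀ γ, m γ ≤ M) {θ : ℝ} (hθ0 : 0 ≤ θ) (hθ1 : θ ≤ 1) (hord : ∀ γ, 1 ≤ ord γ)
    {ε : P → ℝ} {bd : P → Prop} [DecidablePred bd] {cr : ℝ} (hcr : 0 ≤ cr) (hε0 : ∀ r, 0 ≤ ε r)
    (hint : ∀ r, ¬ bd r → ε r ≤ Real.exp (-cr * (reg r).card) ∧ (reg r).Nonempty) (hbd : ∀ r, bd r → ε r ≤ 1)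
    {far : Finset ι → Prop} (hfarB : ∀ r, bd r → ∀ X, reg r ⊆ X → ¬ far X)
    (hT : ∀ γ x a, a ∈ choices m spec pc γ → |term m spec T Cstd E γ x a| ≤ θ ^ ord γ * ∏ i, ((a i).elim (1 : ℝ) ε))
    {θ' β' : ℝ} (hθ'0 : 0 < θ') (S1a : 2 * (q : ℝ) ^ M * Real.exp (-(cr / 4)) ≤ θ' ^ β')
    (S1b : 4 * Fintype.card D * θ * Real.exp (-(cr / 4)) ≤ θ' ^ ((nbar : ℝ) + 1))
    (W' : Finset ι) {X : Finset ι} (hX : far X) :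
    |∑ x ∈ W', ∑ γ, ∑ a ∈ ((choices m spec pc γ).erase (fun _ => none)).filter (fun a => loc m reg γ x a = X),
        term m spec T Cstd E γ x a|
      ≤ (1 / 4) * θ' ^ ((nbar : ℝ) + 1 + β' * X.card) := by
  refine (abs_piecePart_le_far m spec T Cstd pc E reg ord hq hN hM hθ0 hθ1 hord hcr hε0 hint hbd hfarB hT W' hX).trans ?_
  rw [rpow_lin hθ'0]
  have hv0 : 0 ≤ Real.exp (-(cr / 4)) := Real.exp_nonneg _
  have hv1 : Real.exp (-(cr / 4)) ≤ 1 := Real.exp_le_one_iff.2 (by linarith)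
  have hsq : Real.exp (-(cr / 2)) = Real.exp (-(cr / 4)) * Real.exp (-(cr / 4)) := by rw [← Real.exp_add]; congr 1; ring
  rcases Nat.eq_zero_or_pos X.card with hn0 | hn1
  · rw [hn0]
    simp only [Nat.cast_zero, zero_mul, pow_zero, mul_one]
    positivity
  · have h1 : (X.card : ℝ) * (q : ℝ) ^ (M * X.card) * Real.exp (-(cr / 4)) ^ X.card ≤ (θ' ^ β') ^ X.card := by
      rw [pow_mul]
      exact (nat_mul_pow_le (by positivity) hv0 X.card).trans (pow_le_pow_left₀ (by positivity) S1a X.card)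
    have h2 : Fintype.card D * θ * Real.exp (-(cr / 4)) ≤ 1 / 4 * θ' ^ ((nbar : ℝ) + 1) := by linarith
    have h3 : Real.exp (-(cr / 4)) ^ X.card ≤ Real.exp (-(cr / 4)) :=
      (pow_le_pow_of_le_one hv0 hv1 hn1).trans_eq (pow_one _)
    calc (X.card : ℝ) * Fintype.card D * (q : ℝ) ^ (M * X.card) * θ * Real.exp (-(cr / 2)) ^ X.card
        = ((X.card : ℝ) * (q : ℝ) ^ (M * X.card) * Real.exp (-(cr / 4)) ^ X.card)
            * (Fintype.card D * θ * Real.exp (-(cr / 4)) ^ X.card) := by rw [hsq, mul_pow]; ring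
      _ ≤ (θ' ^ β') ^ X.card * (1 / 4 * θ' ^ ((nbar : ℝ) + 1)) := by
          refine mul_le_mul h1 ?_ (by positivity) (by positivity)
          exact (mul_le_mul_of_nonneg_left h3 (by positivity)).trans h2
      _ = 1 / 4 * (θ' ^ ((nbar : ℝ) + 1) * (θ' ^ β') ^ X.card) := by ring

/-- **Source (i) at any `X`, printed shape**: `|piece part(X)| ≤ ¼·θ′^{β′|X|}` under (S1a) and (S4) `4|D|θ(2q^M)^{b₁} ≤ (θ′^{β′})^{b₁}`, `b₁ = 1 + Mb₀`
(the boundary pieces cost only their *"small power of coupling constants"* θ; `0 < θ′ ≤ 1`, `0 ≤ β′`). [cite: BalabanImbrieJaffe1988, p.311 (Sect. 5.14)] -/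
theorem abs_piecePart_le_near_rpow {q M b₀ : ℕ} (hq : 1 ≤ q) (hN : ∀ s X, ((pc s).filter (fun r => reg r ⊆ X)).card + 1 ≤ q ^ X.card)
    (hM : ∀ γ, m γ ≤ M) {θ : ℝ} (hθ0 : 0 ≤ θ) (hθ1 : θ ≤ 1) (hord : ∀ γ, 1 ≤ ord γ)
    {ε : P → ℝ} {bd : P → Prop} [DecidablePred bd] {cr : ℝ} (hcr : 0 ≤ cr) (hε0 : ∀ r, 0 ≤ ε r)
    (hint : ∀ r, ¬ bd r → ε r ≤ Real.exp (-cr * (reg r).card)) (hbd : ∀ r, bd r → ε r ≤ 1 ∧ (reg r).card ≤ b₀)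
    (hT : ∀ γ x a, a ∈ choices m spec pc γ → |term m spec T Cstd E γ x a| ≤ θ ^ ord γ * ∏ i, ((a i).elim (1 : ℝ) ε))
    {θ' β' : ℝ} (hθ'0 : 0 < θ') (hθ'1 : θ' ≤ 1) (hβ' : 0 ≤ β')
    (S1a : 2 * (q : ℝ) ^ M * Real.exp (-(cr / 4)) ≤ θ' ^ β')
    (S4 : 4 * Fintype.card D * θ * (2 * (q : ℝ) ^ M) ^ (1 + M * b₀) ≤ (θ' ^ β') ^ (1 + M * b₀))
    (W' X : Finset ι) :
    |∑ x ∈ W', ∑ γ, ∑ a ∈ ((choices m spec pc γ).erase (fun _ => none)).filter (fun a => loc m reg γ x a = X),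
        term m spec T Cstd E γ x a|
      ≤ (1 / 4) * θ' ^ (β' * X.card) := by
  refine (abs_piecePart_le_near m spec T Cstd pc E reg ord hq hN hM hθ0 hθ1 hord hcr hε0 hint hbd hT W' X).trans ?_
  rw [show θ' ^ (β' * (X.card : ℝ)) = (θ' ^ β') ^ X.card by rw [Real.rpow_mul hθ'0.le, Real.rpow_natCast]]
  have hu1 : (1 : ℝ) ≤ 2 * (q : ℝ) ^ M := by
    have : (1 : ℝ) ≤ (q : ℝ) ^ M := one_le_pow₀ (by exact_mod_cast hq)
    linarith
  have hw0 : 0 ≤ θ' ^ β' := Real.rpow_nonneg hθ'0.le _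
  have hw1 : θ' ^ β' ≤ 1 := Real.rpow_le_one hθ'0.le hθ'1 hβ'
  have huv : 2 * (q : ℝ) ^ M * Real.exp (-cr) ≤ θ' ^ β' :=
    (mul_le_mul_of_nonneg_left (Real.exp_le_exp.2 (by linarith)) (by linarith)).trans S1a
  have hd : X.card ≤ (1 + M * b₀) + (X.card - (1 + M * b₀)) := le_add_tsub
  have hnq : (X.card : ℝ) * (q : ℝ) ^ (M * X.card) ≤ (2 * (q : ℝ) ^ M) ^ X.card := by
    have h := nat_mul_pow_le (show (0 : ℝ) ≤ (q : ℝ) ^ M by positivity) zero_le_one X.card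
    rw [one_pow, mul_one, mul_one, ← pow_mul] at h
    exact h
  have hB : (X.card : ℝ) * (q : ℝ) ^ (M * X.card) ≤ (2 * (q : ℝ) ^ M) ^ ((1 + M * b₀) + (X.card - (1 + M * b₀))) :=
    hnq.trans (pow_le_pow_right₀ hu1 hd)
  have hS4 : Fintype.card D * θ * (2 * (q : ℝ) ^ M) ^ (1 + M * b₀) ≤ 1 / 4 * (θ' ^ β') ^ (1 + M * b₀) := by linarith
  calc (X.card : ℝ) * Fintype.card D * (q : ℝ) ^ (M * X.card) * θ * Real.exp (-cr) ^ (X.card - (1 + M * b₀))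
      = (Fintype.card D * θ) * ((X.card : ℝ) * (q : ℝ) ^ (M * X.card)) * Real.exp (-cr) ^ (X.card - (1 + M * b₀)) := by ring
    _ ≤ (Fintype.card D * θ) * (2 * (q : ℝ) ^ M) ^ ((1 + M * b₀) + (X.card - (1 + M * b₀)))
          * Real.exp (-cr) ^ (X.card - (1 + M * b₀)) :=
        mul_le_mul_of_nonneg_right (mul_le_mul_of_nonneg_left hB (by positivity)) (by positivity)
    _ = (Fintype.card D * θ * (2 * (q : ℝ) ^ M) ^ (1 + M * b₀))
          * (2 * (q : ℝ) ^ M * Real.exp (-cr)) ^ (X.card - (1 + M * b₀)) := by rw [pow_add, mul_pow]; ring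
    _ ≤ (1 / 4 * (θ' ^ β') ^ (1 + M * b₀)) * (θ' ^ β') ^ (X.card - (1 + M * b₀)) :=
        mul_le_mul hS4 (pow_le_pow_left₀ (by positivity) huv _) (by positivity) (by positivity)
    _ = 1 / 4 * (θ' ^ β') ^ ((1 + M * b₀) + (X.card - (1 + M * b₀))) := by rw [pow_add]; ring
    _ ≤ 1 / 4 * (θ' ^ β') ^ X.card := mul_le_mul_of_nonneg_left (pow_le_pow_of_le_one hw0 hw1 hd) (by norm_num)

omit [DecidableEq P] in
/-- **Source (ii), printed shape**: `|high part(X)| ≤ ¼·θ′^{n̄+1+β′|X|}` under (S2) `4|D|θ^{n̄+1} ≤ θ′^{n̄+1+β′}` (it lives on single cubes).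
[cite: BalabanImbrieJaffe1988, p.310 (Sect. 5.14)] -/
theorem abs_highPart_le_rpow {θ : ℝ} (hθ0 : 0 ≤ θ) (hθ1 : θ ≤ 1) (hstd : ∀ γ x, |std m spec T Cstd γ x| ≤ θ ^ ord γ)
    {θ' β' : ℝ} (hθ'0 : 0 < θ') (S2 : 4 * Fintype.card D * θ ^ (nbar + 1) ≤ θ' ^ ((nbar : ℝ) + 1 + β')) (W' X : Finset ι) :
    |∑ x ∈ W'.filter (fun x => ({x} : Finset ι) = X), ∑ γ ∈ univ.filter (fun γ => nbar < ord γ), std m spec T Cstd γ x|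
      ≤ (1 / 4) * θ' ^ ((nbar : ℝ) + 1 + β' * X.card) := by
  by_cases hX : X.card = 1
  · rw [hX, Nat.cast_one, mul_one]
    have := abs_highPart_le m spec T Cstd ord nbar hθ0 hθ1 hstd W' X
    linarith
  · rw [highPart_eq_zero_of_card_ne_one m spec T Cstd ord nbar W' X hX, abs_zero]
    positivity

omit [DecidableEq P] in
/-- **Source (iii), printed shape**: `|reloc part(X)| ≤ ¼·θ′^{β′|X|}` under (S3) `4|D|θ ≤ θ′^{β′}` (single cubes of `Λ̄₈ ∖ Λ₁₂`).
[cite: BalabanImbrieJaffe1988, p.311 (Sect. 5.14)] -/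
theorem abs_relocPart_le_rpow {θ : ℝ} (hθ0 : 0 ≤ θ) (hθ1 : θ ≤ 1) (hord : ∀ γ, 1 ≤ ord γ)
    (hstd : ∀ γ x, |std m spec T Cstd γ x| ≤ θ ^ ord γ) {θ' β' : ℝ} (hθ'0 : 0 < θ') (S3 : 4 * Fintype.card D * θ ≤ θ' ^ β')
    (A W' X : Finset ι) :
    |∑ x ∈ (A \ W').filter (fun x => ({x} : Finset ι) = X), ∑ γ ∈ univ.filter (fun γ => ord γ ≤ nbar), std m spec T Cstd γ x|
      ≤ (1 / 4) * θ' ^ (β' * X.card) := by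
  by_cases hX : X.card = 1
  · rw [hX, Nat.cast_one, mul_one]
    have := abs_relocPart_le m spec T Cstd ord nbar hθ0 hθ1 hord hstd A W' X
    linarith
  · rw [relocPart_eq_zero_of_card_ne_one m spec T Cstd ord nbar A W' X hX, abs_zero]
    positivity

omit [DecidableEq ι] in
/-- **The `W₆′` half**: the leaf `IneqW6′` (p. 310: `|W₆′(X)| ≤ θ₁^{n̄+1+β₁|X|}`) at constants with `4θ₁^{n̄+1} ≤ θ′^{n̄+1}`, `θ₁^{β₁} ≤ θ′^{β′}` gives
`|W₆′(X)| ≤ ¼·θ′^{n̄+1+β′|X|}` (*"We allow adjustments in β, α, β′"*). [cite: BalabanImbrieJaffe1988, p.310 (Sect. 5.14)] -/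
theorem quarter_of_ineqW6' {W6p : Finset ι → ℝ} {θ₁ β₁ θ' β' : ℝ} (hθ₁ : 0 < θ₁) (hθ'0 : 0 < θ')
    (h : IneqW6' (cubeSys ι) W6p θ₁ β₁ nbar) (hA : 4 * θ₁ ^ ((nbar : ℝ) + 1) ≤ θ' ^ ((nbar : ℝ) + 1)) (hB : θ₁ ^ β₁ ≤ θ' ^ β')
    (X : Finset ι) : |W6p X| ≤ (1 / 4) * θ' ^ ((nbar : ℝ) + 1 + β' * X.card) := by
  refine (h X).trans ?_
  rw [cubeSys_card, rpow_lin hθ₁, rpow_lin hθ'0]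
  have h1 : (θ₁ ^ β₁) ^ X.card ≤ (θ' ^ β') ^ X.card := pow_le_pow_left₀ (Real.rpow_nonneg hθ₁.le _) hB _
  calc θ₁ ^ ((nbar : ℝ) + 1) * (θ₁ ^ β₁) ^ X.card ≤ (1 / 4 * θ' ^ ((nbar : ℝ) + 1)) * (θ' ^ β') ^ X.card :=
        mul_le_mul (by linarith) h1 (by positivity) (by positivity)
    _ = 1 / 4 * (θ' ^ ((nbar : ℝ) + 1) * (θ' ^ β') ^ X.card) := by ring

/-! ## §3 The assembly: r16's leaf `IneqW6` inhabited for `W₆ = W₆′ + W₆″` -/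

omit [DecidableEq ι] in
/-- **The two cases assembled.**  If `|W₆′(X)| ≤ ¼θ′^{n̄+1+β′|X|}`, source (i) is `≤ ¼θ′^{n̄+1+β′|X|}` at far `X` and `≤ ¼θ′^{β′|X|}` always, source (ii)
is `≤ ¼θ′^{n̄+1+β′|X|}`, and source (iii) VANISHES at far `X` and is `≤ ¼θ′^{β′|X|}` always (`0 < θ′ ≤ 1`), then `W₆ = W₆′ + ((i) + (ii) − (iii))`
satisfies the printed two-case bound `IneqW6`. [cite: BalabanImbrieJaffe1988, p.311 (Sect. 5.14)] -/
theorem ineqW6_of_parts {W6p R1 R2 R3 : Finset ι → ℝ} {far : Finset ι → Prop} {θ' β' : ℝ} (hθ'0 : 0 < θ') (hθ'1 : θ' ≤ 1)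
    (h6p : ∀ X, |W6p X| ≤ (1 / 4) * θ' ^ ((nbar : ℝ) + 1 + β' * X.card))
    (h1far : ∀ X, far X → |R1 X| ≤ (1 / 4) * θ' ^ ((nbar : ℝ) + 1 + β' * X.card))
    (h1 : ∀ X, |R1 X| ≤ (1 / 4) * θ' ^ (β' * X.card))
    (h2 : ∀ X, |R2 X| ≤ (1 / 4) * θ' ^ ((nbar : ℝ) + 1 + β' * X.card))
    (h3far : ∀ X, far X → R3 X = 0) (h3 : ∀ X, |R3 X| ≤ (1 / 4) * θ' ^ (β' * X.card)) :
    IneqW6 (cubeSys ι) (fun X => W6p X + (R1 X + R2 X - R3 X)) far θ' β' nbar := by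
  have hmono : ∀ X : Finset ι, θ' ^ ((nbar : ℝ) + 1 + β' * X.card) ≤ θ' ^ (β' * X.card) := fun X =>
    Real.rpow_le_rpow_of_exponent_ge hθ'0 hθ'1 (by linarith [(Nat.cast_nonneg nbar : (0 : ℝ) ≤ nbar)])
  refine ⟨fun X hX => ?_, fun X _ => ?_⟩
  · simp only [cubeSys_card]
    rw [h3far X hX, sub_zero]
    have hn : 0 ≤ θ' ^ ((nbar : ℝ) + 1 + β' * X.card) := Real.rpow_nonneg hθ'0.le _
    calc |W6p X + (R1 X + R2 X)| ≤ |W6p X| + (|R1 X| + |R2 X|) := (abs_add_le _ _).trans (by gcongr; exact abs_add_le _ _)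
      _ ≤ _ := by linarith [h6p X, h1far X hX, h2 X]
  · simp only [cubeSys_card]
    have hn : 0 ≤ θ' ^ ((nbar : ℝ) + 1 + β' * X.card) := Real.rpow_nonneg hθ'0.le _
    calc |W6p X + (R1 X + R2 X - R3 X)| ≤ |W6p X| + ((|R1 X| + |R2 X|) + |R3 X|) :=
          (abs_add_le _ _).trans (by gcongr; exact (abs_sub _ _).trans (by gcongr; exact abs_add_le _ _))
      _ ≤ _ := by linarith [h6p X, h1 X, h2 X, h3 X, hmono X]

/-- **p. 311, the two-case bound for `W₆ = W₆′ + W₆″` — r16's leaf `IneqW6` INHABITED.**  Under the printed-shape source bounds (T) (vertex factor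
`θ ∈ [0,1]` per term, `ord ≥ 1`, sizes of the pieces), (RW) (interior pieces: `ε r ≤ e^{−cr|reg r|}`, `reg r ≠ ∅`), (B) (boundary pieces: `ε r ≤ 1`,
`|reg r| ≤ b₀`, regions near `Λ₁₂^c`: `reg r ⊆ X → ¬ far X`), (N) (multiplicity `q`), `m γ ≤ M`, `far X → X ⊆ W′ = Λ₁₂`, the smallness conditions
(S1a) (S1b) (S2) (S3) (S4) on the adjusted `0 < θ′ ≤ 1`, `0 ≤ β′`, and the `W₆′` leaf `IneqW6′ (cubeSys ι) W₆′ θ₁ β₁ n̄` with `4θ₁^{n̄+1} ≤ θ′^{n̄+1}`,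
`θ₁^{β₁} ≤ θ′^{β′}`:  `IneqW6 (cubeSys ι) (W₆′ + W6pp A W′) far θ′ β′ n̄`, i.e. *"|W₆(X)| ≤ θ′^{n̄+1+β′|X|}, dist(X, Λ₁₂^c) ≥ r(e_k); θ′^{β′|X|},
otherwise"* for the `W₆″` of `BIJ88Extraction311.extraction311`. [cite: BalabanImbrieJaffe1988, p.311 (Sect. 5.14)] -/
theorem ineqW6_of_extraction {q M b₀ : ℕ} (hq : 1 ≤ q) (hN : ∀ s X, ((pc s).filter (fun r => reg r ⊆ X)).card + 1 ≤ q ^ X.card)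
    (hM : ∀ γ, m γ ≤ M) {θ : ℝ} (hθ0 : 0 ≤ θ) (hθ1 : θ ≤ 1) (hord : ∀ γ, 1 ≤ ord γ)
    {ε : P → ℝ} {bd : P → Prop} [DecidablePred bd] {cr : ℝ} (hcr : 0 ≤ cr) (hε0 : ∀ r, 0 ≤ ε r)
    (hint : ∀ r, ¬ bd r → ε r ≤ Real.exp (-cr * (reg r).card) ∧ (reg r).Nonempty)
    (hbd : ∀ r, bd r → ε r ≤ 1 ∧ (reg r).card ≤ b₀)
    {far : Finset ι → Prop} (hfarB : ∀ r, bd r → ∀ X, reg r ⊆ X → ¬ far X) {A W' : Finset ι} (hfarW : ∀ X, far X → X ⊆ W')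
    (hT : ∀ γ x a, a ∈ choices m spec pc γ → |term m spec T Cstd E γ x a| ≤ θ ^ ord γ * ∏ i, ((a i).elim (1 : ℝ) ε))
    {θ' β' θ₁ β₁ : ℝ} (hθ'0 : 0 < θ') (hθ'1 : θ' ≤ 1) (hβ' : 0 ≤ β') (hθ₁ : 0 < θ₁)
    (S1a : 2 * (q : ℝ) ^ M * Real.exp (-(cr / 4)) ≤ θ' ^ β')
    (S1b : 4 * Fintype.card D * θ * Real.exp (-(cr / 4)) ≤ θ' ^ ((nbar : ℝ) + 1))
    (S2 : 4 * Fintype.card D * θ ^ (nbar + 1) ≤ θ' ^ ((nbar : ℝ) + 1 + β'))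
    (S3 : 4 * Fintype.card D * θ ≤ θ' ^ β')
    (S4 : 4 * Fintype.card D * θ * (2 * (q : ℝ) ^ M) ^ (1 + M * b₀) ≤ (θ' ^ β') ^ (1 + M * b₀))
    {W6p : Finset ι → ℝ} (hW6p : IneqW6' (cubeSys ι) W6p θ₁ β₁ nbar)
    (hA1 : 4 * θ₁ ^ ((nbar : ℝ) + 1) ≤ θ' ^ ((nbar : ℝ) + 1)) (hB1 : θ₁ ^ β₁ ≤ θ' ^ β') :
    IneqW6 (cubeSys ι) (fun X => W6p X + W6pp m spec T Cstd pc E reg ord nbar A W' X) far θ' β' nbar := by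
  have hstd : ∀ γ x, |std m spec T Cstd γ x| ≤ θ ^ ord γ := abs_std_le m spec T Cstd pc E ord hT
  exact ineqW6_of_parts nbar hθ'0 hθ'1 (quarter_of_ineqW6' nbar hθ₁ hθ'0 hW6p hA1 hB1)
    (fun X hX => abs_piecePart_le_far_rpow m spec T Cstd pc E reg ord nbar hq hN hM hθ0 hθ1 hord hcr hε0 hint
      (fun r hr => (hbd r hr).1) hfarB hT hθ'0 S1a S1b W' hX)
    (fun X => abs_piecePart_le_near_rpow m spec T Cstd pc E reg ord hq hN hM hθ0 hθ1 hord hcr hε0 (fun r hr => (hint r hr).1) hbd hT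
      hθ'0 hθ'1 hβ' S1a S4 W' X)
    (fun X => abs_highPart_le_rpow m spec T Cstd ord nbar hθ0 hθ1 hstd hθ'0 S2 W' X)
    (fun X hX => relocPart_eq_zero_of_far m spec T Cstd ord nbar hfarW A hX)
    (fun X => abs_relocPart_le_rpow m spec T Cstd ord nbar hθ0 hθ1 hord hstd hθ'0 S3 A W' X)

end

end Literature.MathematicalPhysics.QuantumFieldTheory.BalabanImbrieJaffe1984to88.BIJ88Extraction311TwoCase
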